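import Literature.Analysis.FluidPDE.KNSSMildVorticityProofs
import Literature.Analysis.FluidPDE.OseenHeatKernelBridge
import Literature.Analysis.FluidPDE.KNSSSmoothingHolds
import Literature.Analysis.FluidPDE.KNSSMildDecay
import Literature.Analysis.FluidPDE.SolenoidalL2Duality
import Literature.Analysis.FluidPDE.NSLerayStrongLocalExistence
import HarnessLib

/-!
# Smooth local solutions of Navier–Stokes on `ℝ³` from bounded data, and their periodicity

Analysis/FluidPDE proofs file (everything proved; no definitions, no named facts) on the
discharge path of `Literature.Barriers.NavierStokesRegularity.CoiculescuPalasek2025_globalExtension`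
(`Barriers/NavierStokesRegularity/CriticalDataSmoothNonuniquenessProofs.lean`: small smooth
mean-zero data on `𝕋³` at a time `T` launch a global classical solution; Coiculescu–Palasek,
Invent. Math. 244 (2025), §5, last paragraph, with the classical small-data theory). The local
existence step of that continuation argument is obtained here from the tree's (now fully proved)
`L^∞` theory of the Oseen integral equation on the whole space (Koch–Nadirashvili–Seregin–Šverák
2009, §4: Prop. 4.1 in its local form (L) `knss2009_local_smoothing`, the smoothing (P)
`knss2009_smoothing`, uniqueness of bounded solutions `oseenMild_bounded_unique`, and
"mild ⇒ weak ⇒ classical", `OseenDuhamelWeakStokes`, `integral_inner_momentum_eq_zero_of_slab_weak`,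
`PressureReconstruction`), applied to periodic data (Giga–Inui–Matsui 1999: the `L^∞` theory is
the natural home of spatially periodic solutions, which need not decay):

* `weakNS_identity_of_mild_datum` — a bounded measurable field `u` on `ℝ × E` (`dim E = 3`) with
  `u(τ) + ∫₀^τ 𝒩_{τ−σ}(u ⊗ u) dσ = e^{τΔ}a` on `(0, T')` for a bounded measurable datum `a`
  satisfies the weak Navier–Stokes identity against divergence-free space–time test fields on the
  slab `(0, T') × E` (the datum form of `IsKNSSDriftMild.isBoundedWeakNSSolutionOn_of_mem_Ioo`,
  same proof: the Duhamel integral is a weak Stokes solution with forcing `−∇·(u ⊗ u)`, the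
  caloric part a homogeneous one);
* `exists_classical_of_bounded_data` — **local classical solutions from bounded data**: in
  dimension `3` there are `ε₀ > 0`, `C₀ ≥ 1` such that every measurable, weakly divergence-free
  `a : E → E` with `‖a‖ ≤ M` (`0 < M`) launches on `(0, ε₀/M²)` a classical solution `(v, p)` of
  the unforced system (`ν = 1`) which is the (pointwise) solution of
  `v(t) = e^{tΔ}a − B¹₀(v,v)(t)` there, is jointly measurable on `ℝ × E` (we return the field
  truncated by `0` outside the slab), obeys `‖v‖ ≤ C₀M`, and inherits every period of the datum:
  `a(c + ·) = a ⇒ v(t, c + ·) = v(t)` (translation covariance of the integral equation and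
  uniqueness of bounded solutions).

## Mathlib / tree search

Tree (`lean search`): `knss2009_local_smoothing_holds`, `knss2009_smoothing_holds`,
`oseenMild_bounded_unique`, `driftDuhamel_zero_eq_oseenDuhamel`,
`integral_inner_driftDuhamel_zero_heatAdjoint_eq`, `isWeaklyDivFree_driftDuhamel_zero`,
`integral_integral_inner_heatExtension_heatAdjoint_eq_zero`,
`IsWeaklyDivFree.heatExtension_of_bound`, `isDivFree_of_ae_isWeaklyDivFree_of_smooth`,
`integral_inner_momentum_eq_zero_of_slab_weak`,
`exists_isClassicalNSSolutionOn_of_forall_integral_inner_eq_zero`,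
`heatExtension_spaceTranslate_sub`, `oseenDuhamel_spaceTranslate_sub`. Mathlib:
`ContinuousOn.measurable_piecewise`, `Continuous.ae_eq_iff_eq`, `memLp_top_of_bound`.

## References

* G. Koch, N. Nadirashvili, G. Seregin, V. Šverák, *Liouville theorems for the Navier–Stokes
  equations and applications*, Acta Math. 203 (2009) 83–105 = arXiv:0709.3599, §4 p. 8
  ((4.3)–(4.5), Prop. 4.1, (i)–(ii)). [KochNadirashviliSereginSverak2009]
* Y. Giga, K. Inui, S. Matsui, *On the Cauchy problem for the Navier–Stokes equations with
  nondecaying initial data*, Quaderni di Matematica 4 (1999) 27–68, Thm. 1 (local existence,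
  uniqueness and regularity for `u₀ ∈ L^∞`, in particular for periodic data).
* M. P. Coiculescu, S. Palasek, Invent. Math. 244 (2025) = arXiv:2503.14699, §5 (last
  paragraph). [CoiculescuPalasek2025]
-/

noncomputable section

open MeasureTheory Set Function Filter TopologicalSpace InnerProductSpace Metric
open _root_.Topology
open scoped RealInnerProductSpace Laplacian ContDiff NNReal ENNReal Interval

namespace Literature.Analysis.FluidPDE

/-! ### The weak Navier–Stokes identity of a bounded solution of the integral equation -/

section WeakFromDatum

variable {E : Type*} [NormedAddCommGroup E] [InnerProductSpace ℝ E] [FiniteDimensional ℝ E]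
  [MeasurableSpace E] [BorelSpace E]

open Classical in
/-- **A bounded solution of the integral equation is a weak Navier–Stokes solution on its slab**
(datum form of `IsKNSSDriftMild.isBoundedWeakNSSolutionOn_of_mem_Ioo`; KNSS 2009, §4 (i)–(ii):
mild solutions are weak solutions). Let `dim E = 3`, let `u : ℝ → E → E` be jointly measurable
and bounded by `N`, and let `a : E → E` be measurable and bounded by `N`, with
`u(τ) + ∫₀^τ 𝒩_{τ−σ}(u ⊗ u) dσ = e^{τΔ}a` pointwise for `τ ∈ (0, T')`. Then for every space–time
test field `ψ` on the slab `(0, T') × E` with divergence-free slices,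
`∫₀^{T'} ∫ (⟪u, ∂ₜψ⟫ + ⟪u, (u·∇)ψ⟫ + ⟪u, Δψ⟫) = 0`: the Duhamel integral is a weak solution of
the Stokes system with forcing `−∇·(u ⊗ u)` (`integral_inner_driftDuhamel_zero_heatAdjoint_eq`)
and the caloric part of the homogeneous one
(`integral_integral_inner_heatExtension_heatAdjoint_eq_zero`). [cite: KochNadirashviliSereginSverak2009, §4 (i)–(ii) (arXiv:0709.3599v1 p. 8)] -/
theorem weakNS_identity_of_mild_datum (hE : Module.finrank ℝ E = 3) {T' N : ℝ} (hT' : 0 < T')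
    {u : ℝ → E → E} {a : E → E} (hum : Measurable (uncurry u)) (huM : ∀ τ x, ‖u τ x‖ ≤ N)
    (ham : AEStronglyMeasurable a volume) (haN : ∀ x, ‖a x‖ ≤ N)
    (hrep : ∀ τ ∈ Ioo 0 T', ∀ x,
      u τ x + driftDuhamel u (fun _ => (0 : E)) 0 τ x = UnboundedOperators.heatExtension a τ x)
    (ψ : ℝ → E → E) (hψ : IsSpaceTimeTestOn (slab E (Ioo 0 T') isOpen_Ioo) ψ)
    (hψd : ∀ t, VectorCalculus.IsDivFree (ψ t)) :
    ∫ t in Ioo 0 T', ∫ x, (⟪u t x, timeDeriv ψ t x⟫ + ⟪u t x, convect (u t) (ψ t) x⟫ +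
      1 * ⟪u t x, Δ (ψ t) x⟫) = 0 := by
  haveI : CompleteSpace E := FiniteDimensional.complete ℝ E
  have hN : 0 ≤ N := (norm_nonneg _).trans (haN 0)
  have hψ' : IsSpaceTimeTestOn (⊤ : Opens (ℝ × E)) ψ := hψ.mono le_top
  set Λ : ℝ → E → E := fun t x => timeDeriv ψ t x + (1 : ℝ) • Δ (ψ t) x with hΛ_def
  have hΛ : IsSpaceTimeTestOn (⊤ : Opens (ℝ × E)) Λ := hψ'.heatAdjointField_top 1
  have hΛeq : ∀ t x, timeDeriv ψ t x + Δ (ψ t) x = Λ t x := fun t x => by simp [hΛ_def]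
  set D : ℝ → E → E := fun t x => driftDuhamel u (fun _ => (0 : E)) 0 t x with hD_def
  -- the two identities
  have hW := integral_inner_driftDuhamel_zero_heatAdjoint_eq hE hum huM hT' hψ hψd
  have hC := integral_integral_inner_heatExtension_heatAdjoint_eq_zero ham haN hT' hψ
  simp_rw [hΛeq] at hW hC ⊢
  -- integrability on the slab
  have hslm : ∀ τ, AEStronglyMeasurable (u τ) volume := fun τ =>
    (hum.comp (measurable_const.prodMk measurable_id)).aestronglyMeasurable
  have hmeas' : AEStronglyMeasurable (uncurry u)
      ((volume.restrict (Ioc 0 T')).prod (volume : Measure E)) := hum.aestronglyMeasurable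
  have hmono : volume.restrict (Ioo (0:ℝ) T') ≤ volume.restrict (Ioc 0 T') :=
    Measure.restrict_mono Ioo_subset_Ioc_self le_rfl
  have hP : Integrable (fun t => ∫ x, ⟪u t x, Λ t x⟫) (volume.restrict (Ioo 0 T')) :=
    ((integrable_prod_inner_test_of_norm_le hmeas' (fun t _ => hslm t) (fun t _ x => huM t x)
      hΛ).integral_prod_left).mono_measure hmono
  have hQ : Integrable (fun t => ∫ x, ⟪u t x, fderiv ℝ (ψ t) x (u t x)⟫)
      (volume.restrict (Ioo 0 T')) :=
    ((integrable_prod_inner_convect_test_of_norm_le hmeas' (fun t _ => hslm t)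
      (fun t _ x => huM t x) hψ').integral_prod_left).mono_measure hmono
  have hDm : AEStronglyMeasurable (uncurry D)
      ((volume.restrict (Ioc 0 T')).prod (volume : Measure E)) :=
    aestronglyMeasurable_uncurry_driftDuhamel_zero hE hum huM le_rfl
  have hDsl : ∀ t ∈ Ioc (0:ℝ) T', AEStronglyMeasurable (D t) volume := fun t ht =>
    (continuous_integral_sum_oseenHeat_duhamel hE
      (FluidPDE.measurable_driftTensor hum measurable_const)
      (by positivity) ht.1.le (fun σ _ => abs_driftTensor_zero_le huM σ)).aestronglyMeasurable
  have hDM : ∀ t ∈ Ioc (0:ℝ) T', ∀ x, ‖D t x‖ ≤ 70632 * N ^ 2 * T' ^ (1 / 2 : ℝ) :=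
    fun t ht x => norm_driftDuhamel_zero_le hE hum huM (Ioc_subset_Icc_self ht) x
  have hR : Integrable (fun t => ∫ x, ⟪D t x, Λ t x⟫) (volume.restrict (Ioo 0 T')) :=
    ((integrable_prod_inner_test_of_norm_le hDm hDsl hDM hΛ).integral_prod_left).mono_measure
      hmono
  have hLint : ∀ t, Integrable (Λ t) volume := fun t =>
    (hΛ.contDiff_slice t).continuous.integrable_of_hasCompactSupport (hΛ.hasCompactSupport_slice t)
  -- slice identities
  have e1 : ∀ t ∈ Ioo (0:ℝ) T', ∫ x, ⟪UnboundedOperators.heatExtension a t x, Λ t x⟫ =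
      (∫ x, ⟪u t x, Λ t x⟫) + ∫ x, ⟪D t x, Λ t x⟫ := by
    intro t ht
    have i1 : Integrable (fun x => ⟪u t x, Λ t x⟫) volume :=
      integrable_inner_of_aestronglyMeasurable_of_norm_le (hslm t) (fun x => huM t x) (hLint t)
    have i2 : Integrable (fun x => ⟪D t x, Λ t x⟫) volume :=
      integrable_inner_of_aestronglyMeasurable_of_norm_le (hDsl t ⟨ht.1, ht.2.le⟩)
        (fun x => hDM t ⟨ht.1, ht.2.le⟩ x) (hLint t)
    rw [← integral_add i1 i2]
    refine integral_congr_ae (Eventually.of_forall fun x => ?_)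
    show ⟪UnboundedOperators.heatExtension a t x, Λ t x⟫ = ⟪u t x, Λ t x⟫ + ⟪D t x, Λ t x⟫
    rw [← inner_add_left, hrep t ht x]
  have e2 : ∀ t ∈ Ioo (0:ℝ) T',
      (∫ x, (⟪u t x, timeDeriv ψ t x⟫ + ⟪u t x, convect (u t) (ψ t) x⟫ + 1 * ⟪u t x, Δ (ψ t) x⟫)) =
        (∫ x, ⟪u t x, Λ t x⟫) + ∫ x, ⟪u t x, fderiv ℝ (ψ t) x (u t x)⟫ := by
    intro t ht
    have iP : Integrable (fun x => ⟪u t x, Λ t x⟫) volume :=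
      integrable_inner_of_aestronglyMeasurable_of_norm_le (hslm t) (fun x => huM t x) (hLint t)
    have iQ : Integrable (fun x => ⟪u t x, fderiv ℝ (ψ t) x (u t x)⟫) volume :=
      (integrable_inner_clm_apply_of_norm_le (hslm t) (fun x => huM t x)
        ((hψ'.fderiv_top.contDiff_slice t).continuous.integrable_of_hasCompactSupport
          (hψ'.fderiv_top.hasCompactSupport_slice t))).1
    rw [← integral_add iP iQ]
    refine integral_congr_ae (Eventually.of_forall fun x => ?_)
    simp only [hΛ_def, inner_add_right, real_inner_smul_right, convect_apply]
    ring
  -- `∫∫⟨e^{tΔ}a, Λ⟩ = ∫∫⟨u, Λ⟩ + ∫∫⟨D, Λ⟩ = 0`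
  have hsum : (∫ t in Ioo 0 T', ∫ x, ⟪u t x, Λ t x⟫) + ∫ t in Ioo 0 T', ∫ x, ⟪D t x, Λ t x⟫ = 0 := by
    rw [← integral_add hP hR, ← setIntegral_congr_fun measurableSet_Ioo e1]
    exact hC
  have hW' : ∫ t in Ioo 0 T', ∫ x, ⟪D t x, Λ t x⟫ =
      ∫ t in Ioo 0 T', ∫ x, ⟪u t x, fderiv ℝ (ψ t) x (u t x)⟫ := by
    rw [hD_def]
    simpa only [convect_apply] using hW
  rw [setIntegral_congr_fun measurableSet_Ioo e2, integral_add hP hQ, ← hW']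
  exact hsum

end WeakFromDatum

/-! ### Local classical solutions from bounded data, and their periods -/

section Local

variable {E : Type*} [NormedAddCommGroup E] [InnerProductSpace ℝ E] [FiniteDimensional ℝ E]
  [MeasurableSpace E] [BorelSpace E]

open Classical in
/-- **Local classical solutions of Navier–Stokes from bounded data (KNSS 2009, §4; Giga–Inui–Matsui
1999, Thm. 1), with inheritance of the periods of the datum.** Let `dim E = 3`. There are
`ε₀ > 0` and `C₀ ≥ 1` such that for every `M > 0` and every measurable, weakly divergence-free
datum `a : E → E` with `‖a‖ ≤ M` there is a classical solution `(v, p)` of the unforced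
Navier–Stokes system (`ν = 1`) on `(0, ε₀/M²) × E` such that: `v` solves the Oseen integral
equation `v(t) = e^{tΔ}a − B¹₀(v, v)(t)` pointwise there; `v` is jointly measurable on `ℝ × E`
and vanishes at times outside `(0, ε₀/M²)` (the field is returned truncated by `0` off the slab,
which changes nothing on it: `IsClassicalNSSolutionOn.congr_velocity`); `‖v(t, x)‖ ≤ C₀M`; and
every period of `a` is a period of all the slices, `a(c + ·) = a ⇒ v(t, c + ·) = v(t, ·)`.
Proof: the local
solution of (L) `knss2009_local_smoothing` (orders `k = l = 0`) is its own canonical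
representative, hence jointly smooth by (P) `knss2009_smoothing`; truncated outside the slab it
is a bounded measurable field solving the integral equation in the heat-flow realisation
(`driftDuhamel_zero_eq_oseenDuhamel`), hence a weak Navier–Stokes solution on the slab
(`weakNS_identity_of_mild_datum`) with weakly — and by smoothness genuinely — divergence-free
slices (`IsWeaklyDivFree.heatExtension_of_bound`, `isWeaklyDivFree_driftDuhamel_zero`,
`isDivFree_of_ae_isWeaklyDivFree_of_smooth`), so it satisfies the projected momentum equation
(`integral_inner_momentum_eq_zero_of_slab_weak`) and carries a pressure
(`exists_isClassicalNSSolutionOn_of_forall_integral_inner_eq_zero`); the translate `v(t, c + ·)`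
solves the same integral equation (translation covariance of `e^{tΔ}` and of `B¹₀`) with the same
bound, so it coincides with `v` a.e. (`oseenMild_bounded_unique`) and, both being continuous,
everywhere. [cite: KochNadirashviliSereginSverak2009, §4 (4.3)–(4.5), Prop. 4.1, (i)–(ii) (arXiv:0709.3599v1 p. 8)] -/
theorem exists_classical_of_bounded_data (hE : Module.finrank ℝ E = 3) :
    ∃ ε₀ : ℝ, 0 < ε₀ ∧ ∃ C₀ : ℝ, 1 ≤ C₀ ∧
      ∀ ⦃M : ℝ⦄, 0 < M → ∀ ⦃a : E → E⦄, Measurable a → IsWeaklyDivFree a → (∀ x, ‖a x‖ ≤ M) →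
        ∃ (v : ℝ → E → E) (p : ℝ → E → ℝ),
          IsClassicalNSSolutionOn (Ioo 0 (ε₀ / M ^ 2)) 1 0 v p ∧
          Measurable (uncurry v) ∧
          (∀ t ∉ Ioo 0 (ε₀ / M ^ 2), v t = 0) ∧
          (∀ t ∈ Ioo 0 (ε₀ / M ^ 2), ∀ x,
            v t x = UnboundedOperators.heatExtension a t x - oseenDuhamel 1 0 v v t x) ∧
          (∀ t x, ‖v t x‖ ≤ C₀ * M) ∧
          (∀ c : E, (∀ y, a (c + y) = a y) → ∀ t x, v t (c + x) = v t x) := by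
  haveI : CompleteSpace E := FiniteDimensional.complete ℝ E
  obtain ⟨ε, hε, C, hC, hL⟩ := knss2009_local_smoothing_holds E 0 0
  refine ⟨ε, hε, max C 1, le_max_right _ _, fun M hM a ham hdiv haM => ?_⟩
  set h : ℝ := ε / M ^ 2 with hh
  have hhpos : 0 < h := by positivity
  have hwin : (0 : ℝ) + ε * 1 / M ^ 2 = h := by rw [hh]; ring
  -- the datum in `L^∞`
  have ham' : AEStronglyMeasurable a volume := ham.aestronglyMeasurable
  have htop : ∀ {g : E → E} {B : ℝ}, (∀ y, ‖g y‖ ≤ B) → eLpNorm g ∞ volume ≤ ENNReal.ofReal B := by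
    intro g B hg
    rw [eLpNorm_exponent_top]
    refine eLpNormEssSup_le_of_ae_enorm_bound (Eventually.of_forall fun y => ?_)
    rw [← ofReal_norm]
    exact ENNReal.ofReal_le_ofReal (hg y)
  -- (L): the local solution of the integral equation
  obtain ⟨v, hvc, hveq, hvM, -⟩ := hL one_pos 0 hM ham' (htop haM)
  rw [hwin] at hvc hveq hvM
  set M' : ℝ := max C 1 * M with hM'
  have hMM' : M ≤ M' := le_mul_of_one_le_left hM.le (le_max_right _ _)
  have hCM' : C * M ≤ M' := mul_le_mul_of_nonneg_right (le_max_left _ _) hM.le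
  have hM'0 : 0 ≤ M' := hM.le.trans hMM'
  have haM' : ∀ y, ‖a y‖ ≤ M' := fun y => (haM y).trans hMM'
  have hvM' : ∀ t ∈ Ioo (0 : ℝ) h, ∀ x, ‖v t x‖ ≤ M' := fun t ht x => (hvM t ht x).trans hCM'
  -- (P): `v` is its own canonical representative, hence jointly smooth on the slab
  have hslab : MeasurableSet (Ioo (0 : ℝ) h ×ˢ (univ : Set E)) :=
    measurableSet_Ioo.prod MeasurableSet.univ
  have hvm : AEStronglyMeasurable (uncurry v) (volume.restrict (Ioo 0 h ×ˢ univ)) :=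
    hvc.continuousOn.aestronglyMeasurable hslab
  have hvid : ∀ t ∈ Ioo (0 : ℝ) h, v t =ᵐ[volume] fun x =>
      UnboundedOperators.heatExtension a (1 * (t - 0)) x - oseenDuhamel 1 0 v v t x :=
    fun t ht => Eventually.of_forall fun x => hveq t ht x
  obtain ⟨hwsm, -, -⟩ := knss2009_smoothing_holds E one_pos hhpos hM'0 ham' (htop haM') hvm
    (fun t ht => htop (hvM' t ht)) hvid
  have hvsm : IsSmoothSpaceTimeOn (Ioo 0 h) v := by
    refine hwsm.congr fun q hq => ?_
    obtain ⟨t, x⟩ := q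
    exact hveq t (mem_prod.1 hq).1 x
  -- truncation outside the slab: a bounded measurable field on `ℝ × E`
  set u : ℝ → E → E := (Ioo (0 : ℝ) h).piecewise v 0 with hudef
  have hu_in : ∀ τ ∈ Ioo (0 : ℝ) h, u τ = v τ := fun τ hτ => Set.piecewise_eq_of_mem _ _ _ hτ
  have hu_out : ∀ τ ∉ Ioo (0 : ℝ) h, u τ = 0 := fun τ hτ => Set.piecewise_eq_of_notMem _ _ _ hτ
  have hum : Measurable (uncurry u) := by
    have he : uncurry u = (Ioo (0 : ℝ) h ×ˢ (univ : Set E)).piecewise (uncurry v) 0 := by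
      funext q
      by_cases hq : q.1 ∈ Ioo (0 : ℝ) h
      · rw [Set.piecewise_eq_of_mem _ _ _ (mk_mem_prod hq (mem_univ q.2))]
        simp only [uncurry, hu_in q.1 hq]
      · rw [Set.piecewise_eq_of_notMem _ _ _ (fun hm => hq (mem_prod.1 hm).1)]
        simp only [uncurry, hu_out q.1 hq, Pi.zero_apply]
    rw [he]
    exact hvc.continuousOn.measurable_piecewise continuousOn_const hslab
  have huM : ∀ τ x, ‖u τ x‖ ≤ M' := by
    intro τ x
    by_cases hτ : τ ∈ Ioo (0 : ℝ) h
    · rw [hu_in τ hτ]; exact hvM' τ hτ x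
    · rw [hu_out τ hτ]; simpa using hM'0
  -- the Duhamel terms of `u` and `v` agree on the slab, in both realisations
  have hDuv : ∀ τ ∈ Ioo (0 : ℝ) h, ∀ x, oseenDuhamel 1 0 u u τ x = oseenDuhamel 1 0 v v τ x := by
    intro τ hτ x
    rw [oseenDuhamel_apply, oseenDuhamel_apply]
    refine setIntegral_congr_fun measurableSet_Ioo fun σ hσ => ?_
    have hσ' : σ ∈ Ioo (0 : ℝ) h := ⟨hσ.1, hσ.2.trans hτ.2⟩
    simp only [hu_in σ hσ']
  have hdrift : ∀ τ ∈ Ioo (0 : ℝ) h, ∀ x,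
      driftDuhamel u (fun _ => (0 : E)) 0 τ x = oseenDuhamel 1 0 v v τ x := by
    intro τ hτ x
    have hVm : ∀ σ ∈ Ioo (0 : ℝ) τ, Measurable (u σ) := fun σ _ =>
      hum.comp (measurable_const.prodMk measurable_id)
    have hVN : ∀ σ ∈ Ioo (0 : ℝ) τ, ∀ y, ‖u σ y‖ ≤ M' := fun σ _ y => huM σ y
    rw [← hDuv τ hτ x, ← driftDuhamel_zero_eq_oseenDuhamel hE hVm hVN hτ.1.le x]
    rfl
  have hrep : ∀ τ ∈ Ioo (0 : ℝ) h, ∀ x,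
      u τ x + driftDuhamel u (fun _ => (0 : E)) 0 τ x =
        UnboundedOperators.heatExtension a τ x := by
    intro τ hτ x
    rw [hdrift τ hτ x, hu_in τ hτ, hveq τ hτ x, one_mul, sub_zero, sub_add_cancel]
  -- the weak Navier–Stokes identity on the slab
  have hweak := weakNS_identity_of_mild_datum hE hhpos hum huM ham' haM' hrep
  have hweakv : ∀ ψ : ℝ → E → E, IsSpaceTimeTestOn (slab E (Ioo 0 h) isOpen_Ioo) ψ →
      (∀ t, VectorCalculus.IsDivFree (ψ t)) →
      ∫ t in Ioo 0 h, ∫ x, (⟪v t x, timeDeriv ψ t x⟫ + ⟪v t x, convect (v t) (ψ t) x⟫ +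
        1 * ⟪v t x, Δ (ψ t) x⟫) = 0 := by
    intro ψ hψ hψd
    refine Eq.trans (setIntegral_congr_fun measurableSet_Ioo fun t ht => ?_) (hweak ψ hψ hψd)
    simp only [hu_in t ht]
  -- divergence-free slices: weakly from the integral equation, genuinely by smoothness
  have hwdiv : ∀ t ∈ Ioo (0 : ℝ) h, IsWeaklyDivFree (v t) := by
    intro t ht
    have hheat : IsWeaklyDivFree (UnboundedOperators.heatExtension a t) :=
      hdiv.heatExtension_of_bound ham' haM ht.1
    have hD : IsWeaklyDivFree (driftDuhamel u (fun _ => (0 : E)) 0 t) :=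
      isWeaklyDivFree_driftDuhamel_zero hE hum huM ht.1
    have hheat_c : Continuous (UnboundedOperators.heatExtension a t) :=
      (UnboundedOperators.contDiff_heatExtension_holds
        (memLp_top_of_bound ham' M (Eventually.of_forall haM)) le_top ht.1).continuous
    have hvt_c : Continuous (v t) := (hvsm.contDiff_slice ht).continuous
    have hfun : v t = UnboundedOperators.heatExtension a t -
        driftDuhamel u (fun _ => (0 : E)) 0 t := by
      funext x
      have h1 := hrep t ht x
      rw [hu_in t ht] at h1
      rw [Pi.sub_apply, ← h1, add_sub_cancel_right]
    have hDfun : driftDuhamel u (fun _ => (0 : E)) 0 t =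
        UnboundedOperators.heatExtension a t - v t := by
      funext x
      have h1 := hrep t ht x
      rw [hu_in t ht] at h1
      rw [Pi.sub_apply, ← h1, add_sub_cancel_left]
    have hD_li : LocallyIntegrable (driftDuhamel u (fun _ => (0 : E)) 0 t) volume := by
      rw [hDfun]
      exact hheat_c.locallyIntegrable.sub hvt_c.locallyIntegrable
    rw [hfun]
    exact hheat.sub_of_locallyIntegrable hD hheat_c.locallyIntegrable hD_li
  have hdivv : ∀ t ∈ Ioo (0 : ℝ) h, VectorCalculus.IsDivFree (v t) := fun t ht =>
    isDivFree_of_ae_isWeaklyDivFree_of_smooth hvsm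
      ((ae_restrict_iff' measurableSet_Ioo).2 (Eventually.of_forall hwdiv)) ht
  -- the projected momentum equation and the pressure
  have horth : ∀ τ ∈ Ioo (0 : ℝ) h, ∀ φ : E → E,
      FunctionSpaces.IsTestFunctionOn (⊤ : Opens E) φ → VectorCalculus.IsDivFree φ →
        ∫ y, ⟪timeDerivWithin (Ioo 0 h) v τ y + convect (v τ) (v τ) y - (1 : ℝ) • (Δ (v τ)) y -
          (0 : ℝ → E → E) τ y, φ y⟫ = 0 :=
    fun τ hτ φ hφ hφd => integral_inner_momentum_eq_zero_of_slab_weak hvsm hdivv hweakv hτ hφ hφd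
  have hf0 : IsSmoothSpaceTimeOn (Ioo (0 : ℝ) h) (0 : ℝ → E → E) := contDiffOn_const
  obtain ⟨p, hcl⟩ :=
    exists_isClassicalNSSolutionOn_of_forall_integral_inner_eq_zero isOpen_Ioo hvsm hf0 hdivv horth
  -- periods of the datum are periods of the solution
  have hper : ∀ c : E, (∀ y, a (c + y) = a y) →
      ∀ t ∈ Ioo (0 : ℝ) h, ∀ x, v t (c + x) = v t x := by
    intro c hc
    set w : ℝ → E → E := fun τ y => v τ (c + y) with hwdef
    have hheat_tr : ∀ (r : ℝ) (x : E), UnboundedOperators.heatExtension a r (c + x) =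
        UnboundedOperators.heatExtension a r x := by
      intro r x
      rw [UnboundedOperators.heatExtension_apply, UnboundedOperators.heatExtension_apply]
      refine integral_congr_ae (Eventually.of_forall fun y => ?_)
      simp only [show c + x - y = c + (x - y) by abel, hc]
    have hduh_tr : ∀ (τ : ℝ) (x : E),
        oseenDuhamel 1 0 v v τ (c + x) = oseenDuhamel 1 0 w w τ x := by
      intro τ x
      rw [oseenDuhamel_apply, oseenDuhamel_apply]
      refine setIntegral_congr_fun measurableSet_Ioo fun σ _ => ?_
      rw [← integral_add_left_eq_self (μ := (volume : Measure E))
        (fun y => oseenKernel (1 * (τ - σ)) (c + x - y) (v σ y) (v σ y)) c]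
      refine integral_congr_ae (Eventually.of_forall fun y => ?_)
      simp only [hwdef, show c + x - (c + y) = x - y by abel]
    have hweq : ∀ t ∈ Ioo (0 : ℝ) h, ∀ x, w t x =
        UnboundedOperators.heatExtension a (1 * (t - 0)) x - oseenDuhamel 1 0 w w t x := by
      intro t ht x
      show v t (c + x) = _
      rw [hveq t ht (c + x), hheat_tr, hduh_tr]
    have hwc : ContinuousOn (uncurry w) (Ioo (0 : ℝ) h ×ˢ univ) := by
      have hι : Continuous fun q : ℝ × E => (q.1, c + q.2) := by fun_prop
      have hcomp : uncurry w = uncurry v ∘ fun q : ℝ × E => (q.1, c + q.2) := rfl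
      rw [hcomp]
      exact hvc.continuousOn.comp hι.continuousOn fun q hq => ⟨(mem_prod.1 hq).1, mem_univ _⟩
    have hwm : AEStronglyMeasurable (uncurry w) (volume.restrict (Ioo 0 h ×ˢ univ)) :=
      hwc.aestronglyMeasurable hslab
    have hwM : ∀ t ∈ Ioo (0 : ℝ) h, ∀ x, ‖w t x‖ ≤ M' := fun t ht x => hvM' t ht (c + x)
    have huniq := oseenMild_bounded_unique
      (U := fun t x => UnboundedOperators.heatExtension a (1 * (t - 0)) x) one_pos hM'0 hvm hwm
      hvM' hwM (fun t ht => Eventually.of_forall fun x => hveq t ht x)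
      (fun t ht => Eventually.of_forall fun x => hweq t ht x)
    intro t ht x
    have hvt : Continuous (v t) := (hvsm.contDiff_slice ht).continuous
    have hwt : Continuous (w t) := hvt.comp (continuous_const.add continuous_id)
    have heq := (hvt.ae_eq_iff_eq volume hwt).1 (huniq t ht)
    exact (congr_fun heq x).symm
  refine ⟨u, p, hcl.congr_velocity hu_in, hum, hu_out, fun t ht x => ?_, huM, fun c hc t x => ?_⟩
  · rw [hu_in t ht, hDuv t ht x, hveq t ht x, one_mul, sub_zero]
  · by_cases ht : t ∈ Ioo (0 : ℝ) h
    · rw [hu_in t ht]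
      exact hper c hc t ht x
    · rw [hu_out t ht]
      rfl

end Local

end Literature.Analysis.FluidPDE

end
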